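import Summits.Parity.GeneralizedHardyLittlewood.Theses.LiouvilleShiftedTables
import Summits.Parity.GeneralizedHardyLittlewood.Theses.DicksonFibration
import Summits.Parity.GeneralizedHardyLittlewood.Theorems.PairsToGHL.Negative.ShiftPairDictionary
import HarnessLib

/-!
# `PairsToGHL` (crux stmt-Parity-9389): the pair slice of GHL, and `PairsToGHL ∧ PairsHL ↔ DimOne`

Route `LiouvilleShiftedTables` (Parity / GeneralizedHardyLittlewood), crux
`PairsToGHL := PairsHL → GeneralizedHardyLittlewood` (stmt-Parity-9389; the same decl text is shared
by routes RoughSemiprimeRigidity, LiouvilleMAD, HullDial), where `PairsHL` (stmt-Parity-9387, inlined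
verbatim in the crux) is the fixed-shift pair asymptotic `∑_{n ≤ N} Λ(n)Λ(n+h) = 𝔖({0,h}) N + o(N)`
for every `h ≥ 1`.

`Theorems/LiouvilleShiftedTablesPairsToGHLReduction.lean` (not imported here) records that, the
fibration item stmt-Parity-0822 being PROVED (`DicksonFibration.Assembly_holds`), the crux is
unconditionally `PairsHL → DicksonFibration.DimOne` (`PairsToGHLReduction.pairsToGHL_iff_pairsHL_imp_dimOne`)
and is implied outright by `DimOne` (`PairsToGHLReduction.pairsToGHL_of_dimOne`). This file adds the
CONSISTENCY of the crux's two ends and the resulting exact identification of "crux + route target"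
with item stmt-Parity-0819:

* `singularSeriesFactor_pair_eq_localFactor`, `singularSeries_pair_eq_singularProduct` — the route's
  Hardy–Littlewood constant `𝔖({0,h}) = Literature.NumberTheory.Sieve.singularSeries {0,h}` EQUALS
  Green–Tao's singular product `∏_p β_p` of the system `(n, n + h)` for every `h ≠ 0` (the ordered
  partial products agree factor by factor, so no convergence is needed) — the normalisation check
  between the hypothesis and the conclusion of the crux, as an importable Theorems lemma (it existed
  only in the crux workfile `Cruxes/PairsToGHL/Disproof.lean`, §7, from which §1 below is adapted,
  over the landed dictionary `Theorems/PairsToGHL/Negative/ShiftPairDictionary.lean`);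
* `pairAsymptotic_of_generalizedHardyLittlewood` — `GHL` gives the pair asymptotic at every shift
  `h ≥ 1` (the `(d, t, L) = (1, 2, 3)` instance on `(n, n + h)`, `K = [-N, N]`: weighted sum
  `= ∑_{n ≤ N} Λ(n)Λ(n+h)`, `β_∞ = N`, `∏_p β_p = 𝔖({0,h})`), stated shift by shift so that it does
  not pose as a proof of the item `PairsHL`; `pairAsymptotic_of_dimOne` — the same from `DimOne`
  through the proved fibration lemma;
* `pairsToGHL_and_pairsHL_iff_dimOne` — **`PairsToGHL ∧ PairsHL ↔ DimOne`**: the crux joined with the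
  route's own target `PairsHL` IS item stmt-Parity-0819 (all `t`, all slopes `aᵢ n + bᵢ`, constants
  uniform up to `L·N`, intervals `K ⊆ [-N, N]`), of which `PairsHL` is the `t = 2`, slope-`1`,
  fixed-shift slice. So no proof of 9389 usable together with the routes' target is weaker than a
  proof of 0819, and 9389 closes by `PairsToGHLReduction.pairsToGHL_of_dimOne` (equivalently
  `fun _ => DicksonFibration.Assembly_holds h`) the moment a proof `h` of 0819 lands.

References: B. Green, T. Tao, *Linear equations in primes*, Ann. of Math. 171 (2010), Conj. 1.2,
Example 1, (1.2), (1.4), (1.7) [GreenTao2010].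
-/

namespace Summit.Parity.GeneralizedHardyLittlewood.Theorems.PairsToGHL

open Summit.Parity.GeneralizedHardyLittlewood.Theses

/-! ### §1 `𝔖({0,h}) = ∏_p β_p((n, n+h))` and the pair slice of `GHL` -/

section Dictionary

open Finset Filter Literature.NumberTheory.Sieve
open scoped ArithmeticFunction.vonMangoldt
open Summit.Parity.GeneralizedHardyLittlewood.Theorems.PairsToGHL.Negative

/-- `ν_{{0,h}}(p) = #{0, h mod p}`. [folklore] -/
theorem tupleResidueCount_pair (h : ℤ) (p : ℕ) :
    tupleResidueCount ({0, h} : Finset ℤ) p = #({0, (h : ZMod p)} : Finset (ZMod p)) := by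
  classical
  unfold tupleResidueCount
  rw [Finset.image_insert, Finset.image_singleton, Int.cast_zero]

/-- Factor by factor, the Hardy–Littlewood Euler factor of `𝔖({0,h})` is Green–Tao's local factor
`β_p` of `(n, n + h)` (`p` prime, `h ≠ 0`): `(1 - ν/p)(1 - 1/p)^{-2}` with `ν = 1` (`p ∣ h`:
`= p/(p-1)`) or `ν = 2` (`p ∤ h`: `= 1 - 1/(p-1)²`). [cite: GreenTao2010, Example 1] -/
theorem singularSeriesFactor_pair_eq_localFactor {h p : ℕ} (hh : h ≠ 0) (hp : p.Prime) :
    singularSeriesFactor ({0, (h : ℤ)} : Finset ℤ) p = localFactor (shiftPairSystem (h : ℤ)) p := by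
  classical
  haveI := Fact.mk hp
  have hcard : ({0, (h : ℤ)} : Finset ℤ).card = 2 :=
    Finset.card_pair (by exact_mod_cast hh.symm)
  have hp2 : (2 : ℝ) ≤ p := by exact_mod_cast hp.two_le
  have hp1 : (p : ℝ) - 1 ≠ 0 := by linarith
  have hp0 : (p : ℝ) ≠ 0 := by linarith
  rw [singularSeriesFactor, hcard, tupleResidueCount_pair, Int.cast_natCast]
  by_cases hdvd : p ∣ h
  · have hzero : ((h : ℕ) : ZMod p) = 0 := (ZMod.natCast_eq_zero_iff h p).mpr hdvd
    rw [hzero, Finset.insert_eq_of_mem (Finset.mem_singleton_self _), Finset.card_singleton,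
      localFactor_shiftPairSystem_of_dvd hp hdvd]
    field_simp
    ring
  · have hne : ((h : ℕ) : ZMod p) ≠ 0 := fun h' => hdvd ((ZMod.natCast_eq_zero_iff h p).mp h')
    rw [Finset.card_pair hne.symm, localFactor_shiftPairSystem_of_not_dvd hp hdvd]
    field_simp
    push_cast
    ring

/-- **`𝔖({0,h}) = ∏_p β_p((n, n+h))`** for every `h ≠ 0`: the ordered partial products coincide term
by term, hence so do their `limUnder`s (no convergence needed).
[cite: GreenTao2010, Example 1 and (1.7)] -/
theorem singularSeries_pair_eq_singularProduct {h : ℕ} (hh : h ≠ 0) :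
    singularSeries ({0, (h : ℤ)} : Finset ℤ) = singularProduct (shiftPairSystem (h : ℤ)) := by
  unfold singularSeries singularProduct
  congr 1
  funext x
  unfold singularSeriesPartial singularProductPartial
  exact Finset.prod_congr rfl fun p hp =>
    singularSeriesFactor_pair_eq_localFactor hh (Nat.mem_primesLE.mp hp).2

/-- **`GHL` gives the Hardy–Littlewood pair asymptotic at every shift `h ≥ 1`**: apply Conjecture 1.2
at `(d, t, L) = (1, 2, 3)` to `(n, n + h)` on `K = [-N, N]` (`N ≥ h`); in the dictionary the weighted
sum is `∑_{n ≤ N} Λ(n)Λ(n+h)`, `β_∞ = N` and `∏_p β_p = 𝔖({0,h})`. Stated shift by shift (it is the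
`d = 1`, `t = 2`, slope-`1`, fixed-shift slice of the conjecture, not a proof of the item `PairsHL`).
[cite: GreenTao2010, Conj. 1.2 and Example 1] -/
theorem pairAsymptotic_of_generalizedHardyLittlewood (hG : _root_.GeneralizedHardyLittlewood)
    {h : ℕ} (hh : 1 ≤ h) :
    (fun N : ℕ => ∑ n ∈ Finset.Icc 1 N, Λ n * Λ (n + h) -
      singularSeries ({0, (h : ℤ)} : Finset ℤ) * N) =o[atTop] fun N : ℕ => (N : ℝ) := by
  have hh0 : h ≠ 0 := by omega
  rw [Asymptotics.isLittleO_iff]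
  intro c hc
  obtain ⟨N₀, hN₀⟩ := hG 1 2 3 le_rfl (by norm_num) c hc
  rw [Filter.eventually_atTop]
  refine ⟨max N₀ h, fun N hN => ?_⟩
  have hNN₀ : N₀ ≤ N := le_of_max_le_left hN
  have hhN : h ≤ N := le_of_max_le_right hN
  have hNpos : 0 < N := lt_of_lt_of_le (by omega) hhN
  have hGN := hN₀ N hNN₀ (shiftPairSystem (h : ℤ))
    (isNondegenerateSystem_shiftPairSystem_iff.mpr (by exact_mod_cast hh0))
    (affLinSize_shiftPairSystem_le hNpos hhN) (realBox 1 N) (convex_Icc _ _) subset_rfl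
  rw [vonMangoldtSum_shiftPairSystem, archFactor_shiftPairSystem,
    ← singularSeries_pair_eq_singularProduct hh0, pow_one] at hGN
  rw [Real.norm_eq_abs, Real.norm_eq_abs, Nat.abs_cast, mul_comm (singularSeries _) (N : ℝ)]
  exact hGN

end Dictionary

/-! ### §2 `DimOne → PairsHL` shift by shift, and `PairsToGHL ∧ PairsHL ↔ DimOne` -/

/-- **`DimOne → PairsHL`**, shift by shift: the one-dimensional conjecture gives (through the fibration
lemma and `pairAsymptotic_of_generalizedHardyLittlewood`) the route's target asymptotic at every fixed
shift. [cite: GreenTao2010, Conj. 1.2] -/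
theorem pairAsymptotic_of_dimOne (hD : DicksonFibration.DimOne) {h : ℕ} (hh : 1 ≤ h) :
    (fun N : ℕ => ∑ n ∈ Finset.Icc 1 N,
        ArithmeticFunction.vonMangoldt n * ArithmeticFunction.vonMangoldt (n + h) -
      Literature.NumberTheory.Sieve.singularSeries ({0, (h : ℤ)} : Finset ℤ) * N) =o[Filter.atTop]
      fun N : ℕ => (N : ℝ) :=
  pairAsymptotic_of_generalizedHardyLittlewood (DicksonFibration.Assembly_holds hD) hh

/-- **Joined with the route's target, the crux IS item stmt-Parity-0819**:
`PairsToGHL ∧ PairsHL ↔ DimOne`. (`→`: the crux applied to the target gives `GHL`, whose `d = 1` case is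
`DimOne` (`N ^ 1 = N`; cf. `EngineToGHL.dimOne_of_generalizedHardyLittlewood`,
`PairsToGHLReduction.pairsToGHL_iff_pairsHL_imp_dimOne`); `←`: the proved fibration lemma
`DicksonFibration.Assembly_holds` gives `GHL`, hence the crux with its hypothesis unused
(cf. `PairsToGHLReduction.pairsToGHL_of_dimOne`), and `PairsHL` is the `(d, t) = (1, 2)`, slope-`1`,
fixed-shift slice (`pairAsymptotic_of_dimOne`).) [cite: GreenTao2010, Conj. 1.2] -/
theorem pairsToGHL_and_pairsHL_iff_dimOne :
    (LiouvilleShiftedTables.PairsToGHL ∧ LiouvilleShiftedTables.PairsHL) ↔ DicksonFibration.DimOne := by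
  refine ⟨fun h t L ht ε hε => ?_,
    fun h => ⟨fun _ => DicksonFibration.Assembly_holds h, fun _ hk => pairAsymptotic_of_dimOne h hk⟩⟩
  obtain ⟨N₀, hN₀⟩ := h.1 h.2 1 t L le_rfl ht ε hε
  refine ⟨N₀, fun N hN Ψ hΨ hL K hK hKN => ?_⟩
  simpa only [pow_one] using hN₀ N hN Ψ hΨ hL K hK hKN

end Summit.Parity.GeneralizedHardyLittlewood.Theorems.PairsToGHL
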